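import Literature.NumberTheory.EllipticCurves.TwoDescentLocalTwo
import Literature.Barriers.BirchSwinnertonDyer.RankNotSumOfLocalInvariantsTwistDyadic
import HarnessLib

/-!
# Rank-2 observatory — the `2`-adic image of the complete `2`-descent for curves with full rational
# `2`-torsion: the decision tables

HONEST FRAMING: per-curve certified theorems and census instruments; no claim on BSD in rank ≥ 2.

For `E : y² = (x - e_i)(x - e_j)(x - e_l)` with integer roots, the complete `2`-descent records a
rational point `(x, y)`, `y ≠ 0`, by the classes of `x - e_i`, `x - e_j` in `ℚ^×/ℚ^×²`; at `p = 2`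
such a class is read by the three bits `(v₂ mod 2, χ₄, χ₈)` (`parityBit 2`, `chi4`, `chi8` of the
tree's `TwoDescentLocalTwo.lean`). This file defines, as COMPUTABLE Boolean tables, the set of
six-bit vectors `(bits of x - e_i, bits of x - e_j)` that the elementary case analysis on `v₂(x - e_i)`
allows (Silverman AEC X.1, Example X.1.5 style, residues modulo `8`):

* `w00 m a u` — configuration `(0,0,m)`: `e_j - e_i = a` odd, `e_l - e_j = 2^m u`, `u` odd, `m ≥ 1`
  (so `e_i` is the root isolated modulo `2`);
* `w11 m a₁ u` — configuration `(1,1,m)`: `e_j - e_i = 2a₁`, `a₁` odd, `e_l - e_j = 2^m u`, `u` odd,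
  `m ≥ 2` (so `v₂(e_i - e_j) = v₂(e_i - e_l) = 1`, `v₂(e_j - e_l) = m`);

each table is a union of "leaves" `∃ e ∈ {…}, ∃ r odd residue, <constraint in ℤ/8> ∧ z = <bits>`, one
per branch of the case tree, together with the membership lemmas (`w00_of_A`, …) used by the theorems
`w00_of_point` / `w11_of_point` of the companion files, and small helpers (a `2`-adic unit minus an odd integer is not a unit; `2^k = 0` in `ℤ/8` for
`k ≥ 3` is reused from the tree's dyadic twist file). The per-curve files of the observatory
evaluate the tables by `decide`. Mined beforehand on 5137 + 883 rank-2 census rows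
(`kernel-hup/two_adic_law_00m.txt`, `two_adic_law_11m.txt`): the tables have exactly `8` elements for
every residue class of `(m, a, u)` and coincide with the observed images `E(ℚ₂)/2E(ℚ₂)`.

## References

* J. H. Silverman, *The Arithmetic of Elliptic Curves*, 2nd ed., GTM 106 (2009), Prop. X.1.4,
  Example X.1.5. [SilvermanAEC2009]
* J. E. Cremona, *Algorithms for Modular Elliptic Curves*, 2nd ed. (1997), Sec. 3.6. [CremonaAlgorithms1997]
-/

set_option linter.dupNamespace false

namespace Summit.BirchSwinnertonDyer.BirchSwinnertonDyer.Rank2Observatory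

open Literature.NumberTheory.EllipticCurves.TwoDescentLocal
open Literature.NumberTheory.EllipticCurves.KramerTwoDescent
open Literature.Barriers.BirchSwinnertonDyer.DokchitserDokchitser2011 (two_pow_eq_zero_of_le)

/-- Six bits: `(v₂ mod 2, χ₄, χ₈)` of `x - e_i` and of `x - e_j`. -/
abbrev Bits6 : Type := ZMod 2 × ZMod 2 × ZMod 2 × ZMod 2 × ZMod 2 × ZMod 2

/-- The six bits of a pair (valuation, odd residue mod `8`), (valuation, odd residue mod `8`). [folklore] -/
def twoBits (v₁ : ℕ) (r₁ : ZMod (2 ^ 3)) (v₂ : ℕ) (r₂ : ZMod (2 ^ 3)) : Bits6 :=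
  ((v₁ : ZMod 2), chi4Of r₁, chi8Of r₁, (v₂ : ZMod 2), chi4Of r₂, chi8Of r₂)

/-- The odd residues modulo `8`. [folklore] -/
def oddRes8 : List (ZMod (2 ^ 3)) := [1, 3, 5, 7]

/-- An odd class mod `8` (`r² = 1`) is one of `1, 3, 5, 7`. [folklore] -/
theorem mem_oddRes8 {r : ZMod (2 ^ 3)} (h : r * r = 1) : r ∈ oddRes8 := by
  revert r h; decide

/-! ### Configuration `(0,0,m)` -/

/-- Leaf A (`v₂(x - e_i) < 0`, even; `e = 2^(-v)`): all factors have that valuation. [folklore] -/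
def w00A (a b : ZMod (2 ^ 3)) (z : Bits6) : Bool :=
  [(4 : ZMod (2 ^ 3)), 0].any fun e => oddRes8.any fun r =>
    decide (r * (r + e * -a) * (r + e * -b) = 1 ∧ z = twoBits 0 r 0 (r + e * -a))

/-- Leaf B (`v₂(x - e_i) > 0`, even; `e = 2^v`): the other two factors are units. [folklore] -/
def w00B (a b : ZMod (2 ^ 3)) (z : Bits6) : Bool :=
  [(4 : ZMod (2 ^ 3)), 0].any fun e => oddRes8.any fun r =>
    decide (r * (-a + e * r) * (-b + e * r) = 1 ∧ z = twoBits 0 r 0 (-a + e * r))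

/-- Leaf C1 (`v₂(x - e_i) = 0`, `1 ≤ t = v₂(x - e_j) < m`). [folklore] -/
def w00C1 (m : ℕ) (a u : ZMod (2 ^ 3)) (z : Bits6) : Bool :=
  (List.range m).any fun t => decide (1 ≤ t) && oddRes8.any fun w =>
    decide ((a + 2 ^ t * w) * w * (w + 2 ^ (m - t) * -u) = 1 ∧ z = twoBits 0 (a + 2 ^ t * w) t w)

/-- Leaf C2 (`v₂(x - e_i) = 0`, `t = v₂(x - e_j) > m`, `t - m` even, `e = 2^(t-m)`). [folklore] -/
def w00C2 (m : ℕ) (a u : ZMod (2 ^ 3)) (z : Bits6) : Bool :=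
  [(4 : ZMod (2 ^ 3)), 0].any fun e => oddRes8.any fun w =>
    decide (a * w * (-u + e * w) = 1 ∧ z = twoBits 0 a m w)

/-- Leaf C3 (`v₂(x - e_i) = 0`, `v₂(x - e_j) = m`, `v₂(x - e_l) = m + s`, `s` even, `e = 2^s`). [folklore] -/
def w00C3 (m : ℕ) (b u : ZMod (2 ^ 3)) (z : Bits6) : Bool :=
  [(4 : ZMod (2 ^ 3)), 0].any fun e => oddRes8.any fun w =>
    decide (b * (u + e * w) * w = 1 ∧ z = twoBits 0 b m (u + e * w))

/-- **The `2`-adic image table, configuration `(0,0,m)`** (`e_j - e_i ≡ a`, `e_l - e_j = 2^m u`):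
the six-bit vectors `(bits of x - e_i, bits of x - e_j)` allowed by the case analysis. [folklore] -/
def w00 (m : ℕ) (a u : ZMod (2 ^ 3)) (z : Bits6) : Bool :=
  w00A a (a + 2 ^ m * u) z || w00B a (a + 2 ^ m * u) z || w00C1 m a u z || w00C2 m a u z ||
    w00C3 m (a + 2 ^ m * u) u z

section Membership00

variable {m : ℕ} {a u b e r w : ZMod (2 ^ 3)}

/-- `e ∈ [4, 0]`. [folklore] -/
private theorem mem_four_zero (he : e = 4 ∨ e = 0) : e ∈ ([(4 : ZMod (2 ^ 3)), 0] : List _) := by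
  rcases he with rfl | rfl <;> decide

/-- Membership, leaf A of `(0,0,m)`. [folklore] -/
theorem w00_of_A (hb : b = a + 2 ^ m * u) (he : e = 4 ∨ e = 0) (hr : r * r = 1)
    (hc : r * (r + e * -a) * (r + e * -b) = 1) : w00 m a u (twoBits 0 r 0 (r + e * -a)) = true := by
  have h : w00A a (a + 2 ^ m * u) (twoBits 0 r 0 (r + e * -a)) = true := by
    subst hb; unfold w00A; simp only [List.any_eq_true, decide_eq_true_eq]
    exact ⟨e, mem_four_zero he, r, mem_oddRes8 hr, hc, rfl⟩
  simp only [w00, h, Bool.true_or]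

/-- Membership, leaf B of `(0,0,m)`. [folklore] -/
theorem w00_of_B (hb : b = a + 2 ^ m * u) (he : e = 4 ∨ e = 0) (hr : r * r = 1)
    (hc : r * (-a + e * r) * (-b + e * r) = 1) : w00 m a u (twoBits 0 r 0 (-a + e * r)) = true := by
  have h : w00B a (a + 2 ^ m * u) (twoBits 0 r 0 (-a + e * r)) = true := by
    subst hb; unfold w00B; simp only [List.any_eq_true, decide_eq_true_eq]
    exact ⟨e, mem_four_zero he, r, mem_oddRes8 hr, hc, rfl⟩
  simp only [w00, h, Bool.true_or, Bool.or_true]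

/-- Membership, leaf C1 of `(0,0,m)`. [folklore] -/
theorem w00_of_C1 {t : ℕ} (ht : 1 ≤ t) (htm : t < m) (hw : w * w = 1)
    (hc : (a + 2 ^ t * w) * w * (w + 2 ^ (m - t) * -u) = 1) :
    w00 m a u (twoBits 0 (a + 2 ^ t * w) t w) = true := by
  have h : w00C1 m a u (twoBits 0 (a + 2 ^ t * w) t w) = true := by
    unfold w00C1
    simp only [List.any_eq_true, List.mem_range, Bool.and_eq_true, decide_eq_true_eq]
    exact ⟨t, htm, ht, w, mem_oddRes8 hw, hc, rfl⟩
  simp only [w00, h, Bool.true_or, Bool.or_true]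

/-- Membership, leaf C2 of `(0,0,m)`. [folklore] -/
theorem w00_of_C2 (he : e = 4 ∨ e = 0) (hw : w * w = 1) (hc : a * w * (-u + e * w) = 1) :
    w00 m a u (twoBits 0 a m w) = true := by
  have h : w00C2 m a u (twoBits 0 a m w) = true := by
    unfold w00C2; simp only [List.any_eq_true, decide_eq_true_eq]
    exact ⟨e, mem_four_zero he, w, mem_oddRes8 hw, hc, rfl⟩
  simp only [w00, h, Bool.true_or, Bool.or_true]

/-- Membership, leaf C3 of `(0,0,m)`. [folklore] -/
theorem w00_of_C3 (hb : b = a + 2 ^ m * u) (he : e = 4 ∨ e = 0) (hw : w * w = 1)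
    (hc : b * (u + e * w) * w = 1) : w00 m a u (twoBits 0 b m (u + e * w)) = true := by
  have h : w00C3 m (a + 2 ^ m * u) u (twoBits 0 b m (u + e * w)) = true := by
    subst hb; unfold w00C3; simp only [List.any_eq_true, decide_eq_true_eq]
    exact ⟨e, mem_four_zero he, w, mem_oddRes8 hw, hc, rfl⟩
  simp only [w00, h, Bool.or_true]

end Membership00

/-! ### Configuration `(1,1,m)` -/

/-- Leaf A (`v₂(x - e_i) < 0`): the class is trivial. [folklore] -/
def w11A (z : Bits6) : Bool :=
  oddRes8.any fun r => decide (r * r * r = 1 ∧ z = twoBits 0 r 0 r)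

/-- Leaf B (`v₂(x - e_i) ≥ 2`, even; `e = 2^(v-1)`). [folklore] -/
def w11B (a₁ b₁ : ZMod (2 ^ 3)) (z : Bits6) : Bool :=
  [(2 : ZMod (2 ^ 3)), 0].any fun e => oddRes8.any fun r =>
    decide (r * (-a₁ + e * r) * (-b₁ + e * r) = 1 ∧ z = twoBits 0 r 1 (-a₁ + e * r))

/-- Leaf C2' (`v₂(x - e_i) = 1`, `t = v₂(x - e_j) > m`, `t - m = s` odd). [folklore] -/
def w11C2 (m : ℕ) (a₁ u : ZMod (2 ^ 3)) (z : Bits6) : Bool :=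
  [1, 3].any fun s => oddRes8.any fun w =>
    decide ((a₁ + 2 ^ (m + s - 1) * w) * w * (-u + 2 ^ s * w) = 1 ∧
      z = twoBits 1 (a₁ + 2 ^ (m + s - 1) * w) (m + 1) w)

/-- Leaf C3' (`v₂(x - e_i) = 1`, `v₂(x - e_j) = m`, `v₂(x - e_l) = m + s`, `s` odd). [folklore] -/
def w11C3 (m : ℕ) (b₁ u : ZMod (2 ^ 3)) (z : Bits6) : Bool :=
  [1, 3].any fun s => oddRes8.any fun w =>
    decide ((b₁ + 2 ^ (m + s - 1) * w) * (u + 2 ^ s * w) * w = 1 ∧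
      z = twoBits 1 (b₁ + 2 ^ (m + s - 1) * w) m (u + 2 ^ s * w))

/-- Leaf C (`v₂(x - e_i) = 0`): all three factors are units. [folklore] -/
def w11C (a₁ b₁ : ZMod (2 ^ 3)) (z : Bits6) : Bool :=
  oddRes8.any fun r => decide (r * (r + 2 * -a₁) * (r + 2 * -b₁) = 1 ∧ z = twoBits 0 r 0 (r + 2 * -a₁))

/-- **The `2`-adic image table, configuration `(1,1,m)`** (`e_j - e_i = 2a₁`, `e_l - e_j = 2^m u`,
`m ≥ 2`, so `e_l - e_i = 2b₁`, `b₁ = a₁ + 2^(m-1) u`). [folklore] -/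
def w11 (m : ℕ) (a₁ u : ZMod (2 ^ 3)) (z : Bits6) : Bool :=
  w11A z || w11B a₁ (a₁ + 2 ^ (m - 1) * u) z || w11C2 m a₁ u z || w11C3 m (a₁ + 2 ^ (m - 1) * u) u z ||
    w11C a₁ (a₁ + 2 ^ (m - 1) * u) z

section Membership11

variable {m : ℕ} {a₁ u b₁ e r w : ZMod (2 ^ 3)}

/-- `e ∈ [2, 0]`. [folklore] -/
private theorem mem_two_zero (he : e = 2 ∨ e = 0) : e ∈ ([(2 : ZMod (2 ^ 3)), 0] : List _) := by
  rcases he with rfl | rfl <;> decide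

/-- Membership, leaf A of `(1,1,m)`. [folklore] -/
theorem w11_of_A (hr : r * r = 1) (hc : r * r * r = 1) : w11 m a₁ u (twoBits 0 r 0 r) = true := by
  have h : w11A (twoBits 0 r 0 r) = true := by
    unfold w11A; simp only [List.any_eq_true, decide_eq_true_eq]
    exact ⟨r, mem_oddRes8 hr, hc, rfl⟩
  simp only [w11, h, Bool.true_or]

/-- Membership, leaf B of `(1,1,m)`. [folklore] -/
theorem w11_of_B (hb : b₁ = a₁ + 2 ^ (m - 1) * u) (he : e = 2 ∨ e = 0) (hr : r * r = 1)
    (hc : r * (-a₁ + e * r) * (-b₁ + e * r) = 1) : w11 m a₁ u (twoBits 0 r 1 (-a₁ + e * r)) = true := by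
  have h : w11B a₁ (a₁ + 2 ^ (m - 1) * u) (twoBits 0 r 1 (-a₁ + e * r)) = true := by
    subst hb; unfold w11B; simp only [List.any_eq_true, decide_eq_true_eq]
    exact ⟨e, mem_two_zero he, r, mem_oddRes8 hr, hc, rfl⟩
  simp only [w11, h, Bool.true_or, Bool.or_true]

/-- Leaf C2' with the actual odd `s = t - m`: `2^s`, `2^(t-1)` are those of `s' = min s 3`. [folklore] -/
theorem w11_of_C2 (hm : 2 ≤ m) {s : ℕ} (hs : Odd s) (hw : w * w = 1)
    (hc : (a₁ + 2 ^ (m + s - 1) * w) * w * (-u + 2 ^ s * w) = 1) :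
    w11 m a₁ u (twoBits 1 (a₁ + 2 ^ (m + s - 1) * w) (m + 1) w) = true := by
  -- reduce to `s' ∈ {1, 3}` with the same powers of two in `ℤ/8`
  obtain ⟨s', hs', hpow, hpow'⟩ : ∃ s' ∈ ([1, 3] : List ℕ), (2 : ZMod (2 ^ 3)) ^ s = 2 ^ s' ∧
      (2 : ZMod (2 ^ 3)) ^ (m + s - 1) = 2 ^ (m + s' - 1) := by
    rcases Nat.lt_or_ge s 3 with h3 | h3
    · refine ⟨s, ?_, rfl, rfl⟩
      obtain ⟨j, rfl⟩ := hs
      have : j = 0 := by omega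
      subst this; decide
    · refine ⟨3, by decide, ?_, ?_⟩
      · rw [two_pow_eq_zero_of_le h3, two_pow_eq_zero_of_le le_rfl]
      · rw [two_pow_eq_zero_of_le (by omega), two_pow_eq_zero_of_le (by omega)]
  have h : w11C2 m a₁ u (twoBits 1 (a₁ + 2 ^ (m + s - 1) * w) (m + 1) w) = true := by
    unfold w11C2; simp only [List.any_eq_true, decide_eq_true_eq]
    refine ⟨s', hs', w, mem_oddRes8 hw, ?_, ?_⟩
    · rw [← hpow, ← hpow']; exact hc
    · rw [hpow']
  simp only [w11, h, Bool.true_or, Bool.or_true]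

/-- Membership, leaf C3' of `(1,1,m)` with the actual odd `s`. [folklore] -/
theorem w11_of_C3 (hb : b₁ = a₁ + 2 ^ (m - 1) * u) (hm : 2 ≤ m) {s : ℕ} (hs : Odd s)
    (hw : w * w = 1) (hc : (b₁ + 2 ^ (m + s - 1) * w) * (u + 2 ^ s * w) * w = 1) :
    w11 m a₁ u (twoBits 1 (b₁ + 2 ^ (m + s - 1) * w) m (u + 2 ^ s * w)) = true := by
  obtain ⟨s', hs', hpow, hpow'⟩ : ∃ s' ∈ ([1, 3] : List ℕ), (2 : ZMod (2 ^ 3)) ^ s = 2 ^ s' ∧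
      (2 : ZMod (2 ^ 3)) ^ (m + s - 1) = 2 ^ (m + s' - 1) := by
    rcases Nat.lt_or_ge s 3 with h3 | h3
    · refine ⟨s, ?_, rfl, rfl⟩
      obtain ⟨j, rfl⟩ := hs
      have : j = 0 := by omega
      subst this; decide
    · refine ⟨3, by decide, ?_, ?_⟩
      · rw [two_pow_eq_zero_of_le h3, two_pow_eq_zero_of_le le_rfl]
      · rw [two_pow_eq_zero_of_le (by omega), two_pow_eq_zero_of_le (by omega)]
  have h : w11C3 m (a₁ + 2 ^ (m - 1) * u) u (twoBits 1 (b₁ + 2 ^ (m + s - 1) * w) m (u + 2 ^ s * w)) =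
      true := by
    subst hb; unfold w11C3; simp only [List.any_eq_true, decide_eq_true_eq]
    refine ⟨s', hs', w, mem_oddRes8 hw, ?_, ?_⟩
    · rw [← hpow, ← hpow']; exact hc
    · rw [hpow, hpow']
  simp only [w11, h, Bool.true_or, Bool.or_true]

/-- Membership, leaf C of `(1,1,m)`. [folklore] -/
theorem w11_of_C (hb : b₁ = a₁ + 2 ^ (m - 1) * u) (hr : r * r = 1)
    (hc : r * (r + 2 * -a₁) * (r + 2 * -b₁) = 1) : w11 m a₁ u (twoBits 0 r 0 (r + 2 * -a₁)) = true := by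
  have h : w11C a₁ (a₁ + 2 ^ (m - 1) * u) (twoBits 0 r 0 (r + 2 * -a₁)) = true := by
    subst hb; unfold w11C; simp only [List.any_eq_true, decide_eq_true_eq]
    exact ⟨r, mem_oddRes8 hr, hc, rfl⟩
  simp only [w11, h, Bool.or_true]

end Membership11

/-! ### Two arithmetic helpers -/

/-- A `2`-adic unit minus an odd integer is not a unit: `v₂(q - a) ≥ 1`. [folklore] -/
theorem one_le_padicValRat_two_sub {q : ℚ} (hq0 : q ≠ 0) (hq : padicValRat 2 q = 0) {a : ℤ}
    (ha : ¬ (2 : ℤ) ∣ a) (h0 : q - a ≠ 0) : 1 ≤ padicValRat 2 (q - a) := by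
  haveI : Fact (Nat.Prime 2) := ⟨Nat.prime_two⟩
  have hden : q.den ≠ 0 := q.den_nz
  -- numerator and denominator of `q` are odd
  have hv : (padicValNat 2 q.num.natAbs : ℤ) = padicValNat 2 q.den := by
    have : padicValRat 2 q = padicValInt 2 q.num - padicValNat 2 q.den := rfl
    rw [hq] at this; unfold padicValInt at this; omega
  have hnum0 : q.num.natAbs ≠ 0 := by
    intro h; exact hq0 (Rat.zero_of_num_zero (Int.natAbs_eq_zero.mp h))
  have hodd : ¬ 2 ∣ q.num.natAbs ∧ ¬ 2 ∣ q.den := by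
    by_cases h2n : 2 ∣ q.num.natAbs
    · exfalso
      have h1 : 1 ≤ padicValNat 2 q.num.natAbs := one_le_padicValNat_of_dvd hnum0 h2n
      have h2d : 2 ∣ q.den := dvd_of_one_le_padicValNat (by omega)
      exact absurd (Nat.Coprime.coprime_dvd_left h2n (Nat.Coprime.coprime_dvd_right h2d q.reduced))
        (by decide)
    · refine ⟨h2n, fun h2d => ?_⟩
      rw [padicValNat.eq_zero_of_not_dvd h2n] at hv
      have := one_le_padicValNat_of_dvd hden h2d; omega
  have hnum : ¬ (2 : ℤ) ∣ q.num := fun h => hodd.1 (Int.ofNat_dvd_left.mp h)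
  have hdenZ : ¬ (2 : ℤ) ∣ (q.den : ℤ) := fun h => hodd.2 (Int.natCast_dvd_natCast.mp h)
  -- `(q - a) · den = num - a · den`, an even non-zero integer
  have hN : (q - a) * (q.den : ℚ) = ((q.num - a * q.den : ℤ) : ℚ) := by
    push_cast; rw [sub_mul, Rat.mul_den_eq_num]
  have hden0 : (q.den : ℚ) ≠ 0 := Nat.cast_ne_zero.mpr hden
  have hN0 : ((q.num - a * q.den : ℤ) : ℚ) ≠ 0 := by rw [← hN]; exact mul_ne_zero h0 hden0
  have hdvd : (2 : ℤ) ∣ q.num - a * q.den := by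
    have hoN : Odd q.num := Int.not_even_iff_odd.mp fun h => hnum (even_iff_two_dvd.mp h)
    have hoA : Odd a := Int.not_even_iff_odd.mp fun h => ha (even_iff_two_dvd.mp h)
    have hoD : Odd (q.den : ℤ) := Int.not_even_iff_odd.mp fun h => hdenZ (even_iff_two_dvd.mp h)
    exact even_iff_two_dvd.mp (hoN.sub_odd (hoA.mul hoD))
  have hvN : 1 ≤ padicValRat 2 (((q.num - a * q.den : ℤ)) : ℚ) :=
    (padicValRat_intCast_of_dvd (p := 2) (z := q.num - a * q.den) hdvd).resolve_left hN0
  have hvden : padicValRat 2 (q.den : ℚ) = 0 := by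
    rw [show (q.den : ℚ) = ((q.den : ℤ) : ℚ) by push_cast; rfl]
    exact padicValRat_intCast_eq_zero hdenZ
  have hmul := padicValRat.mul (p := 2) h0 hden0
  rw [hN, hvden, add_zero] at hmul
  rw [← hmul]; exact hvN

/-- The parity bit from a congruence of the valuation. [folklore] -/
theorem parityBit_two_eq_natCast {d : ℚ} {n : ℕ} (h : (2 : ℤ) ∣ padicValRat 2 d - n) :
    parityBit 2 d = (n : ZMod 2) := by
  unfold parityBit
  rw [← Int.cast_natCast, ZMod.intCast_eq_intCast_iff_dvd_sub]
  obtain ⟨k, hk⟩ := h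
  exact ⟨-k, by push_cast; linarith⟩

end Summit.BirchSwinnertonDyer.BirchSwinnertonDyer.Rank2Observatory
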